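import Mathlib.Analysis.MeanInequalities
import Mathlib.Analysis.MeanInequalitiesPow
import Mathlib.Analysis.Convex.SpecificFunctions.Basic
import Mathlib.Analysis.SpecialFunctions.Pow.Real
import HarnessLib

/-!
# Equality cases of Young's, Hölder's, Minkowski's and Bennett's inequalities (finite sums)

For nonnegative reals and finite index sets:
* `rpow_eq_rpow_of_young_eq` — `ab = a^p/p + b^q/q` forces `a^p = b^q` (strict concavity of `log`);
* `holder_eq_proportional` — equality in Hölder's inequality forces `f^p ∝ g^q`;
* `Lp_finset_sum_le_real`, `minkowski_eq_proportional` — Minkowski for finitely many vectors in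
  `ℓ^r` and its equality case (`r > 1`): every vector is a nonnegative multiple of the sum;
* `le_rpow_of_rpow_one_div_le_real`, `bennett_chain_real`, `bennett_eq_rows_proportional` — the
  three steps of Bennett's proof of `‖(A ⊗ B) R‖_q ≤ ‖A‖_{p→q} ‖B‖_{p→q} ‖R‖_p` (`p ≤ q`) in real form,
  and the consequence of EQUALITY (`p < q`): the Minkowski step is tight, so the `B`-images of the
  rows of `R` are all proportional to one vector — the step "the vectors `r'_j` generate a space of
  dimension one" in Galanis–Štefankovič–Vigoda's Lemma 3.2 (the maximisers of the second-moment
  exponent of a spin system are product measures).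

Companion of `BennettTensorNorm.lean` (the inequality itself, in `ℝ≥0`). Everything proved; no
definitions, no named facts.

## References
* A. Galanis, D. Štefankovič, E. Vigoda, J. ACM 62 (2015), Lemma 3.2 and its proof.
* G. Bennett, *Schur multipliers*, Duke Math. J. 44 (1977).
* G. H. Hardy, J. E. Littlewood, G. Pólya, *Inequalities*, §2.8, §2.11 (equality cases; folklore).
-/

namespace Literature.Analysis.Matrix

open Real Finset

section Young

/-- **Young's inequality, equality case**: for conjugate exponents `p, q` and `a, b ≥ 0`,
`a b = a^p/p + b^q/q` forces `a^p = b^q` (strict concavity of `log`). [folklore] -/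
theorem rpow_eq_rpow_of_young_eq {a b p q : ℝ} (hpq : p.HolderConjugate q) (ha : 0 ≤ a) (hb : 0 ≤ b)
    (h : a * b = a ^ p / p + b ^ q / q) : a ^ p = b ^ q := by
  have hp := hpq.pos
  have hq := hpq.symm.pos
  have hp1 : 1 / p + 1 / q = 1 := by
    have := hpq.inv_add_inv_eq_one; simpa [one_div] using this
  by_contra hne
  set A := a ^ p with hA
  set B := b ^ q with hB
  have hA0 : 0 ≤ A := Real.rpow_nonneg ha _
  have hB0 : 0 ≤ B := Real.rpow_nonneg hb _
  -- both are positive (else the other vanishes too and `A = B`)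
  have hApos : 0 < A := by
    rcases hA0.eq_or_lt with h0 | h0
    · exfalso
      have ha0 : a = 0 := by
        rw [hA] at h0
        exact ((Real.rpow_eq_zero_iff_of_nonneg ha).1 h0.symm).1
      rw [ha0, zero_mul] at h
      have hB' : B = 0 := by
        have : B / q = 0 := by linarith [div_nonneg hA0 hp.le, div_nonneg hB0 hq.le, h0]
        rcases div_eq_zero_iff.1 this with h1 | h1
        · exact h1
        · exact absurd h1 hq.ne'
      exact hne (by rw [← h0, hB'])
    · exact h0
  have hBpos : 0 < B := by
    rcases hB0.eq_or_lt with h0 | h0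
    · exfalso
      have hb0 : b = 0 := by
        rw [hB] at h0
        exact ((Real.rpow_eq_zero_iff_of_nonneg hb).1 h0.symm).1
      rw [hb0, mul_zero] at h
      have hA' : A = 0 := by
        have : A / p = 0 := by linarith [div_nonneg hA0 hp.le, div_nonneg hB0 hq.le, h0]
        rcases div_eq_zero_iff.1 this with h1 | h1
        · exact h1
        · exact absurd h1 hp.ne'
      exact hne (by rw [hA', h0])
    · exact h0
  -- strict Jensen for `log` at the two distinct points `A ≠ B`
  have hJ := strictConcaveOn_log_Ioi.2 hApos hBpos hne (one_div_pos.2 hp) (one_div_pos.2 hq) hp1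
  simp only [smul_eq_mul] at hJ
  -- exponentiate: `A^{1/p} B^{1/q} < A/p + B/q`
  have hlt : A ^ (1 / p) * B ^ (1 / q) < A / p + B / q := by
    have := Real.exp_lt_exp.2 hJ
    rw [Real.exp_add, Real.exp_log (by positivity)] at this
    rw [Real.rpow_def_of_pos hApos, Real.rpow_def_of_pos hBpos]
    convert this using 2 <;> ring_nf
  have hAa : A ^ (1 / p) = a := by rw [hA, one_div, Real.rpow_rpow_inv ha hp.ne']
  have hBb : B ^ (1 / q) = b := by rw [hB, one_div, Real.rpow_rpow_inv hb hq.ne']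
  rw [hAa, hBb] at hlt
  rw [hA, hB] at hlt
  linarith [hlt, h, div_eq_mul_one_div (a ^ p) p, div_eq_mul_one_div (b ^ q) q]

end Young

section Holder

variable {ι : Type*}

/-- **Hölder's inequality, equality case** (finite sums, nonnegative entries, conjugate `p, q`):
`Σ f g = ‖f‖_p ‖g‖_q` forces `f^p` and `g^q` to be proportional: `c f^p = d g^q` termwise for some
`c, d ≥ 0` not both zero. [folklore] -/
theorem holder_eq_proportional (s : Finset ι) (f g : ι → ℝ) {p q : ℝ} (hpq : p.HolderConjugate q)
    (hf : ∀ i ∈ s, 0 ≤ f i) (hg : ∀ i ∈ s, 0 ≤ g i)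
    (h : ∑ i ∈ s, f i * g i = (∑ i ∈ s, f i ^ p) ^ (1 / p) * (∑ i ∈ s, g i ^ q) ^ (1 / q)) :
    ∃ c d : ℝ, 0 ≤ c ∧ 0 ≤ d ∧ (c ≠ 0 ∨ d ≠ 0) ∧ ∀ i ∈ s, c * f i ^ p = d * g i ^ q := by
  have hp := hpq.pos
  have hq := hpq.symm.pos
  set F := ∑ i ∈ s, f i ^ p with hF
  set G := ∑ i ∈ s, g i ^ q with hG
  have hF0 : 0 ≤ F := Finset.sum_nonneg fun i hi => Real.rpow_nonneg (hf i hi) _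
  have hG0 : 0 ≤ G := Finset.sum_nonneg fun i hi => Real.rpow_nonneg (hg i hi) _
  rcases hF0.eq_or_lt with hF0' | hFpos
  · -- `f = 0` on `s`
    refine ⟨1, 0, zero_le_one, le_rfl, Or.inl one_ne_zero, fun i hi => ?_⟩
    have : f i ^ p = 0 := by
      have hle := Finset.single_le_sum (f := fun i => f i ^ p) (fun i hi => Real.rpow_nonneg (hf i hi) _) hi
      rw [← hF, ← hF0'] at hle
      exact le_antisymm hle (Real.rpow_nonneg (hf i hi) _)
    rw [this]; ring
  rcases hG0.eq_or_lt with hG0' | hGpos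
  · refine ⟨0, 1, le_rfl, zero_le_one, Or.inr one_ne_zero, fun i hi => ?_⟩
    have : g i ^ q = 0 := by
      have hle := Finset.single_le_sum (f := fun i => g i ^ q) (fun i hi => Real.rpow_nonneg (hg i hi) _) hi
      rw [← hG, ← hG0'] at hle
      exact le_antisymm hle (Real.rpow_nonneg (hg i hi) _)
    rw [this]; ring
  -- normalise
  set f' : ι → ℝ := fun i => f i / F ^ (1 / p) with hf'
  set g' : ι → ℝ := fun i => g i / G ^ (1 / q) with hg'
  have hFp : 0 < F ^ (1 / p) := Real.rpow_pos_of_pos hFpos _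
  have hGq : 0 < G ^ (1 / q) := Real.rpow_pos_of_pos hGpos _
  have hf'0 : ∀ i ∈ s, 0 ≤ f' i := fun i hi => div_nonneg (hf i hi) hFp.le
  have hg'0 : ∀ i ∈ s, 0 ≤ g' i := fun i hi => div_nonneg (hg i hi) hGq.le
  have hf'p : ∀ i ∈ s, f' i ^ p = f i ^ p / F := by
    intro i hi
    rw [hf', Real.div_rpow (hf i hi) hFp.le, ← Real.rpow_mul hF0, one_div_mul_cancel hp.ne', Real.rpow_one]
  have hg'q : ∀ i ∈ s, g' i ^ q = g i ^ q / G := by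
    intro i hi
    rw [hg', Real.div_rpow (hg i hi) hGq.le, ← Real.rpow_mul hG0, one_div_mul_cancel hq.ne', Real.rpow_one]
  have hsumf : ∑ i ∈ s, f' i ^ p = 1 := by
    rw [Finset.sum_congr rfl hf'p, ← Finset.sum_div, ← hF, div_self hFpos.ne']
  have hsumg : ∑ i ∈ s, g' i ^ q = 1 := by
    rw [Finset.sum_congr rfl hg'q, ← Finset.sum_div, ← hG, div_self hGpos.ne']
  have hsumfg : ∑ i ∈ s, f' i * g' i = 1 := by
    have : ∑ i ∈ s, f' i * g' i = (∑ i ∈ s, f i * g i) / (F ^ (1 / p) * G ^ (1 / q)) := by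
      rw [Finset.sum_div]
      refine Finset.sum_congr rfl fun i _ => ?_
      rw [hf', hg']; field_simp
    rw [this, h, div_self (mul_pos hFp hGq).ne']
  -- termwise Young, summed, is an equality; hence termwise equality
  have hY : ∀ i ∈ s, f' i * g' i ≤ f' i ^ p / p + g' i ^ q / q := fun i hi =>
    Real.young_inequality_of_nonneg (hf'0 i hi) (hg'0 i hi) hpq
  have hsumY : ∑ i ∈ s, (f' i ^ p / p + g' i ^ q / q) = 1 := by
    rw [Finset.sum_add_distrib, ← Finset.sum_div, ← Finset.sum_div, hsumf, hsumg]
    have := hpq.inv_add_inv_eq_one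
    simpa [one_div] using this
  have heq : ∀ i ∈ s, f' i * g' i = f' i ^ p / p + g' i ^ q / q := by
    have h := (Finset.sum_eq_sum_iff_of_le hY).1 (by rw [hsumfg, hsumY])
    exact h
  refine ⟨G, F, hG0, hF0, Or.inl hGpos.ne', fun i hi => ?_⟩
  have hi' := rpow_eq_rpow_of_young_eq hpq (hf'0 i hi) (hg'0 i hi) (heq i hi)
  rw [hf'p i hi, hg'q i hi] at hi'
  field_simp at hi'
  linarith [hi']

end Holder

section Minkowski

variable {ι : Type*} [Fintype ι]

/-- Minkowski for finitely many nonnegative real vectors in `ℓ^r`, `r ≥ 1`: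
`(Σ_k (Σ_{j∈s} a_j(k))^r)^{1/r} ≤ Σ_{j∈s} (Σ_k a_j(k)^r)^{1/r}`. [folklore] -/
theorem Lp_finset_sum_le_real {J : Type*} (s : Finset J) (a : J → ι → ℝ) (ha : ∀ j ∈ s, ∀ k, 0 ≤ a j k)
    {r : ℝ} (hr : 1 ≤ r) :
    (∑ k, (∑ j ∈ s, a j k) ^ r) ^ (1 / r) ≤ ∑ j ∈ s, (∑ k, a j k ^ r) ^ (1 / r) := by
  classical
  induction s using Finset.induction_on with
  | empty =>
    have hr0 : r ≠ 0 := by linarith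
    simp only [Finset.sum_empty, Real.zero_rpow hr0, Finset.sum_const_zero,
      Real.zero_rpow (one_div_ne_zero hr0), le_refl]
  | insert j s hj ih =>
    have ha' : ∀ j' ∈ s, ∀ k, 0 ≤ a j' k := fun j' hj' k => ha j' (Finset.mem_insert_of_mem hj') k
    have haj : ∀ k, 0 ≤ a j k := fun k => ha j (Finset.mem_insert_self j s) k
    rw [Finset.sum_insert hj]
    calc (∑ k, (∑ i ∈ insert j s, a i k) ^ r) ^ (1 / r)
        = (∑ k, (a j k + ∑ i ∈ s, a i k) ^ r) ^ (1 / r) := by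
          simp only [Finset.sum_insert hj]
      _ ≤ (∑ k, a j k ^ r) ^ (1 / r) + (∑ k, (∑ i ∈ s, a i k) ^ r) ^ (1 / r) :=
          Real.Lp_add_le_of_nonneg univ hr (fun k _ => haj k)
            (fun k _ => Finset.sum_nonneg fun i hi => ha' i hi k)
      _ ≤ (∑ k, a j k ^ r) ^ (1 / r) + ∑ i ∈ s, (∑ k, a i k ^ r) ^ (1 / r) :=
          add_le_add le_rfl (ih ha')

/-- **Minkowski's inequality, equality case** (finitely many nonnegative vectors, `r > 1`): if the
`ℓ^r` norm of the sum is the sum of the norms then every vector is a nonnegative multiple of the sum.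
[folklore] -/
theorem minkowski_eq_proportional {J : Type*} (s : Finset J) (a : J → ι → ℝ)
    (ha : ∀ j ∈ s, ∀ k, 0 ≤ a j k) {r : ℝ} (hr : 1 < r)
    (h : (∑ k, (∑ j ∈ s, a j k) ^ r) ^ (1 / r) = ∑ j ∈ s, (∑ k, a j k ^ r) ^ (1 / r)) :
    ∀ j ∈ s, ∃ μ : ℝ, 0 ≤ μ ∧ ∀ k, a j k = μ * ∑ j' ∈ s, a j' k := by
  classical
  have hr0 : 0 < r := by linarith
  set S : ι → ℝ := fun k => ∑ j ∈ s, a j k with hS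
  have hS0 : ∀ k, 0 ≤ S k := fun k => Finset.sum_nonneg fun j hj => ha j hj k
  have haS : ∀ j ∈ s, ∀ k, a j k ≤ S k := fun j hj k =>
    Finset.single_le_sum (f := fun j => a j k) (fun j' hj' => ha j' hj' k) hj
  set Tr : ℝ := ∑ k, S k ^ r with hTr
  have hTr0 : 0 ≤ Tr := Finset.sum_nonneg fun k _ => Real.rpow_nonneg (hS0 k) _
  intro j hj
  rcases hTr0.eq_or_lt with hTr0' | hTrpos
  · -- everything vanishes
    refine ⟨0, le_rfl, fun k => ?_⟩
    have hSk : S k = 0 := by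
      have hle := Finset.single_le_sum (f := fun k => S k ^ r) (fun k _ => Real.rpow_nonneg (hS0 k) _)
        (Finset.mem_univ k)
      rw [← hTr, ← hTr0'] at hle
      have : S k ^ r = 0 := le_antisymm hle (Real.rpow_nonneg (hS0 k) _)
      exact ((Real.rpow_eq_zero_iff_of_nonneg (hS0 k)).1 this).1
    have := haS j hj k
    rw [hSk] at this
    rw [zero_mul]
    exact le_antisymm this (ha j hj k)
  -- conjugate exponent and the weight vector `S^{r-1}`
  have hpq : r.HolderConjugate (r / (r - 1)) := Real.HolderConjugate.conjExponent hr
  set r' := r / (r - 1) with hr'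
  have hr'0 : 0 < r' := hpq.symm.pos
  have hrr' : (r - 1) * r' = r := by
    have : r - 1 ≠ 0 := by linarith
    rw [hr', mul_div_cancel₀ _ this]
  have hW : ∀ k, (S k ^ (r - 1)) ^ r' = S k ^ r := by
    intro k; rw [← Real.rpow_mul (hS0 k), hrr']
  -- Hölder for each `j`, and the sums of both sides agree
  have hX : ∀ j' ∈ s, ∑ k, a j' k * S k ^ (r - 1) ≤
      (∑ k, a j' k ^ r) ^ (1 / r) * (∑ k, (S k ^ (r - 1)) ^ r') ^ (1 / r') := fun j' hj' =>
    Real.inner_le_Lp_mul_Lq_of_nonneg univ hpq (fun k _ => ha j' hj' k)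
      (fun k _ => Real.rpow_nonneg (hS0 k) _)
  have hsumX : ∑ j' ∈ s, ∑ k, a j' k * S k ^ (r - 1) = Tr := by
    rw [Finset.sum_comm]
    refine Finset.sum_congr rfl fun k _ => ?_
    rw [← Finset.sum_mul]
    change S k * S k ^ (r - 1) = S k ^ r
    rcases (hS0 k).eq_or_lt with h0 | hpos
    · rw [← h0, zero_mul, Real.zero_rpow hr0.ne']
    · rw [← Real.rpow_one_add' hpos.le (by linarith), add_sub_cancel]
  have hsumY : ∑ j' ∈ s, (∑ k, a j' k ^ r) ^ (1 / r) * (∑ k, (S k ^ (r - 1)) ^ r') ^ (1 / r') = Tr := by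
    rw [← Finset.sum_mul, ← h]
    simp only [hW]
    change Tr ^ (1 / r) * Tr ^ (1 / r') = Tr
    rw [← Real.rpow_add hTrpos]
    have : 1 / r + 1 / r' = 1 := by
      have := hpq.inv_add_inv_eq_one; simpa [one_div] using this
    rw [this, Real.rpow_one]
  have heq := (Finset.sum_eq_sum_iff_of_le hX).1 (by rw [hsumX, hsumY])
  -- equality in Hölder for our `j`
  obtain ⟨c, d, hc, hd, hcd, hprop⟩ := holder_eq_proportional univ (a j) (fun k => S k ^ (r - 1)) hpq
    (fun k _ => ha j hj k) (fun k _ => Real.rpow_nonneg (hS0 k) _) (heq j hj)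
  simp only [hW] at hprop
  have hcpos : 0 < c := by
    rcases hc.eq_or_lt with h0 | h0
    · exfalso
      have hd0 : d ≠ 0 := by rcases hcd with h | h; exact absurd h0.symm h; exact h
      have : Tr = 0 := by
        refine Finset.sum_eq_zero fun k _ => ?_
        have := hprop k (Finset.mem_univ k)
        rw [← h0, zero_mul] at this
        rcases mul_eq_zero.1 this.symm with h1 | h1
        · exact absurd h1 hd0
        · exact h1
      exact hTrpos.ne' this
    · exact h0
  refine ⟨(d / c) ^ (1 / r), Real.rpow_nonneg (div_nonneg hd hc) _, fun k => ?_⟩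
  have hk : a j k ^ r = d / c * S k ^ r := by
    have := hprop k (Finset.mem_univ k)
    field_simp
    linarith [this]
  calc a j k = (a j k ^ r) ^ (1 / r) := by rw [one_div, Real.rpow_rpow_inv (ha j hj k) hr0.ne']
    _ = (d / c * S k ^ r) ^ (1 / r) := by rw [hk]
    _ = (d / c) ^ (1 / r) * S k := by
        rw [Real.mul_rpow (div_nonneg hd hc) (Real.rpow_nonneg (hS0 k) _), one_div,
          Real.rpow_rpow_inv (hS0 k) hr0.ne']

end Minkowski

section BennettReal

variable {ι κ ι' κ' : Type*} [Fintype ι] [Fintype κ] [Fintype ι'] [Fintype κ']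

/-- From `X^{1/q} ≤ Z` conclude `X ≤ Z^q` (`X ≥ 0`, `q > 0`). [folklore] -/
theorem le_rpow_of_rpow_one_div_le_real {X Z q : ℝ} (hX : 0 ≤ X) (hq : 0 < q) (h : X ^ (1 / q) ≤ Z) :
    X ≤ Z ^ q := by
  have hZ : 0 ≤ Z := (Real.rpow_nonneg hX _).trans h
  have := Real.rpow_le_rpow (Real.rpow_nonneg hX _) h hq.le
  rwa [one_div, Real.rpow_inv_rpow hX hq.ne'] at this

/-- **Bennett's chain, real form**: with `u_k(j) = Σ_l B_{kl} R_{jl}`, `r = q/p` and `T = Σ R^p`,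
the three intermediate inequalities of Bennett's proof:
`Σ_{ik}((A⊗B)R)^q ≤ K_A^q Σ_k (Σ_j u_k(j)^p)^r ≤ K_A^q (Σ_j (Σ_k u_k(j)^q)^{1/r})^r ≤ K_A^q (K_B^p T)^r`.
[cite: GalanisStefankovicVigoda2015, proof of Lemma 3.2 (Bennett's proof of eq. (13))] -/
theorem bennett_chain_real (A : ι → κ → ℝ) (B : ι' → κ' → ℝ) (hA0 : ∀ i j, 0 ≤ A i j)
    (hB0 : ∀ i j, 0 ≤ B i j) {p q : ℝ} (hp : 0 < p) (hpq : p ≤ q) {KA KB : ℝ} (hKA : 0 ≤ KA)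
    (hKB : 0 ≤ KB)
    (hA : ∀ c : κ → ℝ, (∀ j, 0 ≤ c j) →
      (∑ i, (∑ j, A i j * c j) ^ q) ^ (1 / q) ≤ KA * (∑ j, c j ^ p) ^ (1 / p))
    (hB : ∀ c : κ' → ℝ, (∀ j, 0 ≤ c j) →
      (∑ i, (∑ j, B i j * c j) ^ q) ^ (1 / q) ≤ KB * (∑ j, c j ^ p) ^ (1 / p))
    (R : κ → κ' → ℝ) (hR : ∀ j l, 0 ≤ R j l) (u : ι' → κ → ℝ) (hu : ∀ k j, u k j = ∑ l, B k l * R j l) :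
    (∑ ik : ι × ι', (∑ jl : κ × κ', A ik.1 jl.1 * B ik.2 jl.2 * R jl.1 jl.2) ^ q ≤
        KA ^ q * ∑ k, (∑ j, u k j ^ p) ^ (q / p)) ∧
      (∑ k, (∑ j, u k j ^ p) ^ (q / p) ≤ (∑ j, (∑ k, u k j ^ q) ^ (p / q)) ^ (q / p)) ∧
      ((∑ j, (∑ k, u k j ^ q) ^ (p / q)) ^ (q / p) ≤
        (KB ^ p * ∑ jl : κ × κ', R jl.1 jl.2 ^ p) ^ (q / p)) := by
  have hq : 0 < q := hp.trans_le hpq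
  have hp0 : p ≠ 0 := hp.ne'
  have hq0 : q ≠ 0 := hq.ne'
  set r : ℝ := q / p with hr
  have hr1 : 1 ≤ r := by rw [hr, le_div_iff₀ hp, one_mul]; exact hpq
  have hr0 : 0 < r := lt_of_lt_of_le one_pos hr1
  have hpr : p / q = 1 / r := by rw [hr, one_div, inv_div]
  have hu0 : ∀ k j, 0 ≤ u k j := fun k j => by
    rw [hu]; exact Finset.sum_nonneg fun l _ => mul_nonneg (hB0 k l) (hR j l)
  have hinner : ∀ (i : ι) (k : ι'),
      ∑ jl : κ × κ', A i jl.1 * B k jl.2 * R jl.1 jl.2 = ∑ j, A i j * u k j := by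
    intro i k
    rw [Fintype.sum_prod_type]
    refine Finset.sum_congr rfl fun j _ => ?_
    rw [hu, Finset.mul_sum]
    refine Finset.sum_congr rfl fun l _ => ?_
    ring
  set T : ℝ := ∑ jl : κ × κ', R jl.1 jl.2 ^ p with hT
  have hT' : T = ∑ j, ∑ l, R j l ^ p := by rw [hT, Fintype.sum_prod_type]
  refine ⟨?_, ?_, ?_⟩
  · -- step 1: norm bound for `A`, block by block
    have h1 : ∀ k : ι', ∑ i, (∑ j, A i j * u k j) ^ q ≤ KA ^ q * (∑ j, u k j ^ p) ^ r := by
      intro k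
      have hX : 0 ≤ ∑ i, (∑ j, A i j * u k j) ^ q := Finset.sum_nonneg fun i _ =>
        Real.rpow_nonneg (Finset.sum_nonneg fun j _ => mul_nonneg (hA0 i j) (hu0 k j)) _
      have h := le_rpow_of_rpow_one_div_le_real hX hq (hA (u k) (hu0 k))
      rw [Real.mul_rpow hKA (Real.rpow_nonneg (Finset.sum_nonneg fun j _ => Real.rpow_nonneg (hu0 k j) _) _),
        ← Real.rpow_mul (Finset.sum_nonneg fun j _ => Real.rpow_nonneg (hu0 k j) _), one_div_mul_eq_div] at h
      exact h
    calc ∑ ik : ι × ι', (∑ jl : κ × κ', A ik.1 jl.1 * B ik.2 jl.2 * R jl.1 jl.2) ^ q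
        = ∑ k, ∑ i, (∑ j, A i j * u k j) ^ q := by
          rw [Fintype.sum_prod_type, Finset.sum_comm]
          refine Finset.sum_congr rfl fun k _ => Finset.sum_congr rfl fun i _ => ?_
          rw [hinner]
      _ ≤ ∑ k, KA ^ q * (∑ j, u k j ^ p) ^ r := Finset.sum_le_sum fun k _ => h1 k
      _ = KA ^ q * ∑ k, (∑ j, u k j ^ p) ^ r := by rw [Finset.mul_sum]
  · -- step 2: Minkowski in `ℓ^r`
    have hM := Lp_finset_sum_le_real (univ : Finset κ) (fun j k => u k j ^ p)
      (fun j _ k => Real.rpow_nonneg (hu0 k j) _) hr1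
    have hX : 0 ≤ ∑ k, (∑ j, u k j ^ p) ^ r := Finset.sum_nonneg fun k _ =>
      Real.rpow_nonneg (Finset.sum_nonneg fun j _ => Real.rpow_nonneg (hu0 k j) _) _
    have hM' := le_rpow_of_rpow_one_div_le_real hX hr0 hM
    refine hM'.trans (le_of_eq ?_)
    congr 1
    refine Finset.sum_congr rfl fun j _ => ?_
    rw [hpr]
    congr 1
    refine Finset.sum_congr rfl fun k _ => ?_
    rw [← Real.rpow_mul (hu0 k j), hr, mul_div_cancel₀ _ hp0]
  · -- step 3: norm bound for `B`, row by row
    have h3 : ∀ j : κ, ∑ k, u k j ^ q ≤ KB ^ q * (∑ l, R j l ^ p) ^ r := by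
      intro j
      have hX : 0 ≤ ∑ k, (∑ l, B k l * R j l) ^ q := Finset.sum_nonneg fun k _ =>
        Real.rpow_nonneg (by rw [← hu]; exact hu0 k j) _
      have h := le_rpow_of_rpow_one_div_le_real hX hq (hB (R j) (hR j))
      rw [Real.mul_rpow hKB (Real.rpow_nonneg (Finset.sum_nonneg fun l _ => Real.rpow_nonneg (hR j l) _) _),
        ← Real.rpow_mul (Finset.sum_nonneg fun l _ => Real.rpow_nonneg (hR j l) _), one_div_mul_eq_div] at h
      simp only [← hu] at h
      exact h
    have h3' : ∀ j : κ, (∑ k, u k j ^ q) ^ (p / q) ≤ KB ^ p * ∑ l, R j l ^ p := by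
      intro j
      have hsum0 : 0 ≤ ∑ l, R j l ^ p := Finset.sum_nonneg fun l _ => Real.rpow_nonneg (hR j l) _
      have h := Real.rpow_le_rpow (Finset.sum_nonneg fun k _ => Real.rpow_nonneg (hu0 k j) _) (h3 j)
        (div_nonneg hp.le hq.le)
      refine h.trans (le_of_eq ?_)
      rw [Real.mul_rpow (Real.rpow_nonneg hKB _) (Real.rpow_nonneg hsum0 _), ← Real.rpow_mul hKB,
        ← Real.rpow_mul hsum0, hr, show (q : ℝ) * (p / q) = p by field_simp,
        show q / p * (p / q) = 1 by field_simp, Real.rpow_one]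
    have hsum : ∑ j, (∑ k, u k j ^ q) ^ (p / q) ≤ KB ^ p * T := by
      calc ∑ j, (∑ k, u k j ^ q) ^ (p / q) ≤ ∑ j, KB ^ p * ∑ l, R j l ^ p :=
            Finset.sum_le_sum fun j _ => h3' j
        _ = KB ^ p * T := by rw [← Finset.mul_sum, hT']
    exact Real.rpow_le_rpow (Finset.sum_nonneg fun j _ => Real.rpow_nonneg
      (Finset.sum_nonneg fun k _ => Real.rpow_nonneg (hu0 k j) _) _) hsum (div_nonneg hq.le hp.le)

/-- **Equality in Bennett's inequality forces the rows of `R` to have proportional `B`-images**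
(`p < q`, `K_A > 0`): if `‖(A ⊗ B) R‖_q^q = (K_A K_B)^q ‖R‖_p^q` then the Minkowski step is an
equality, so the vectors `k ↦ (B R_j·)_k^p` are all proportional to their sum: there is a common
nonnegative vector `φ` with `(B R_j·)_k = ν_j φ_k`.
[cite: GalanisStefankovicVigoda2015, proof of Lemma 3.2 ("the vectors r'_j … generate space of dimension one")] -/
theorem bennett_eq_rows_proportional (A : ι → κ → ℝ) (B : ι' → κ' → ℝ) (hA0 : ∀ i j, 0 ≤ A i j)
    (hB0 : ∀ i j, 0 ≤ B i j) {p q : ℝ} (hp : 0 < p) (hpq : p < q) {KA KB : ℝ} (hKA : 0 < KA)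
    (hKB : 0 ≤ KB)
    (hA : ∀ c : κ → ℝ, (∀ j, 0 ≤ c j) →
      (∑ i, (∑ j, A i j * c j) ^ q) ^ (1 / q) ≤ KA * (∑ j, c j ^ p) ^ (1 / p))
    (hB : ∀ c : κ' → ℝ, (∀ j, 0 ≤ c j) →
      (∑ i, (∑ j, B i j * c j) ^ q) ^ (1 / q) ≤ KB * (∑ j, c j ^ p) ^ (1 / p))
    (R : κ → κ' → ℝ) (hR : ∀ j l, 0 ≤ R j l)
    (heq : ∑ ik : ι × ι', (∑ jl : κ × κ', A ik.1 jl.1 * B ik.2 jl.2 * R jl.1 jl.2) ^ q =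
      KA ^ q * (KB ^ p * ∑ jl : κ × κ', R jl.1 jl.2 ^ p) ^ (q / p)) :
    ∃ φ : ι' → ℝ, (∀ k, 0 ≤ φ k) ∧ ∀ j, ∃ ν : ℝ, 0 ≤ ν ∧ ∀ k, ∑ l, B k l * R j l = ν * φ k := by
  have hq : 0 < q := hp.trans hpq
  have hp0 : p ≠ 0 := hp.ne'
  set u : ι' → κ → ℝ := fun k j => ∑ l, B k l * R j l with hu
  obtain ⟨h1, h2, h3⟩ := bennett_chain_real A B hA0 hB0 hp hpq.le hKA.le hKB hA hB R hR u (fun k j => rfl)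
  have hu0 : ∀ k j, 0 ≤ u k j := fun k j => Finset.sum_nonneg fun l _ => mul_nonneg (hB0 k l) (hR j l)
  set r : ℝ := q / p with hr
  have hr1 : 1 < r := by rw [hr, lt_div_iff₀ hp, one_mul]; exact hpq
  have hr0 : 0 < r := lt_trans one_pos hr1
  have hpr : p / q = 1 / r := by rw [hr, one_div, inv_div]
  -- equality of the ends forces equality in step 2
  have hX1X2 : ∑ k, (∑ j, u k j ^ p) ^ r = (∑ j, (∑ k, u k j ^ q) ^ (p / q)) ^ r := by
    have hKq : 0 < KA ^ q := Real.rpow_pos_of_pos hKA _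
    refine le_antisymm h2 ?_
    have h' : KA ^ q * (∑ j, (∑ k, u k j ^ q) ^ (p / q)) ^ r ≤ KA ^ q * ∑ k, (∑ j, u k j ^ p) ^ r := by
      calc KA ^ q * (∑ j, (∑ k, u k j ^ q) ^ (p / q)) ^ r
          ≤ KA ^ q * (KB ^ p * ∑ jl : κ × κ', R jl.1 jl.2 ^ p) ^ r :=
            mul_le_mul_of_nonneg_left h3 hKq.le
        _ = ∑ ik : ι × ι', (∑ jl : κ × κ', A ik.1 jl.1 * B ik.2 jl.2 * R jl.1 jl.2) ^ q := heq.symm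
        _ ≤ _ := h1
    exact le_of_mul_le_mul_left h' hKq
  -- Minkowski equality for `a_j(k) = u_k(j)^p` in `ℓ^r`
  have hpow : ∀ k j, (u k j ^ p) ^ r = u k j ^ q := by
    intro k j; rw [← Real.rpow_mul (hu0 k j), hr, mul_div_cancel₀ _ hp0]
  have hY : 0 ≤ ∑ j, (∑ k, u k j ^ q) ^ (p / q) := Finset.sum_nonneg fun j _ =>
    Real.rpow_nonneg (Finset.sum_nonneg fun k _ => Real.rpow_nonneg (hu0 k j) _) _
  have hMeq : (∑ k, (∑ j, u k j ^ p) ^ r) ^ (1 / r) = ∑ j, (∑ k, (u k j ^ p) ^ r) ^ (1 / r) := by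
    simp only [hpow]
    rw [hX1X2, one_div, Real.rpow_rpow_inv hY hr0.ne', hpr, one_div]
  have hprop := minkowski_eq_proportional (univ : Finset κ) (fun j k => u k j ^ p)
    (fun j _ k => Real.rpow_nonneg (hu0 k j) _) hr1 hMeq
  -- extract `φ = (Σ_j u(j)^p)^{1/p}` and `ν_j = μ_j^{1/p}`
  refine ⟨fun k => (∑ j, u k j ^ p) ^ (1 / p), fun k => Real.rpow_nonneg
    (Finset.sum_nonneg fun j _ => Real.rpow_nonneg (hu0 k j) _) _, fun j => ?_⟩
  obtain ⟨μ, hμ, hμk⟩ := hprop j (Finset.mem_univ j)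
  refine ⟨μ ^ (1 / p), Real.rpow_nonneg hμ _, fun k => ?_⟩
  have hk := hμk k
  have hS0 : 0 ≤ ∑ j', u k j' ^ p := Finset.sum_nonneg fun j' _ => Real.rpow_nonneg (hu0 k j') _
  calc ∑ l, B k l * R j l = u k j := rfl
    _ = (u k j ^ p) ^ (1 / p) := by rw [one_div, Real.rpow_rpow_inv (hu0 k j) hp0]
    _ = (μ * ∑ j', u k j' ^ p) ^ (1 / p) := by rw [hk]
    _ = μ ^ (1 / p) * (∑ j', u k j' ^ p) ^ (1 / p) := Real.mul_rpow hμ hS0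

end BennettReal

end Literature.Analysis.Matrix
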